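import Summits.HodgeConjecture.HodgeConjecture.Theorems.R90S5MemAPacketOfMultOfLaws          -- ★ (this seat, p861463) `mem_aPacket_of_m_ne_zero_of_laws` (§13.10 ¶3 membership half over the ★ dictionary)
import Summits.HodgeConjecture.HodgeConjecture.Theorems.R90S5ScPartnerEqPiSSigned           -- ★ (this seat, p861449) `eq_πs_of_charIdentityAtTestSigned` (the signed partner is THE chosen `πˢ`)
import Summits.HodgeConjecture.HodgeConjecture.Theorems.F0P3cDbTEnvelopeTrichotomy         -- ★ brings `MemXiFamily`, `CMCharIdentityPackageTestSigned`, `xiLocalChar`, the constituent currency (as in S5 file D)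
import Literature.NumberTheory.Rogawski1990.CharIdentityOnTestFunctionsSignedLemmas        -- ★ `CMNonsplitCharIdentityAtTestSigned.πs`
import Summits.HodgeConjecture.HodgeConjecture.Theorems.F0P3cStCharTSCharField             -- ★ `qsForm_map_cmConjRingHom_transpose` : `(σΦ₃)ᵀ = Φ₃`
import Summits.HodgeConjecture.HodgeConjecture.Theorems.F0P3cStCharTSShellOrbitalGCan      -- ★ `F0P3cStCharTSShellOrbitalG.isUnit_det_qsForm` : `IsUnit (det Φ₃)`
import HarnessLib

/-!
# R90-TF · S5 «Ch. 13.3 multiplicity ∕ rigidity» — (QS-R♯) AT ONE INSTANCE from a lawful twisted-comparison datum + NAMED PINS: every `v`-constituent of `P` is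
# `πⁿ(ξ_v) ∘ e` OR the chosen `πˢ(ξ_v)` of the signed Q-package — NO `π² ∘ e` disjunct (JQ-S7-9 «sharpen (QS-R) to `πⁿ∘e ∨ πˢ`, drop `π²∘e`»)

Cell `hodgecm-mathlib`, crux H413 (`stmt-HodgeConjecture-24833`), route of record `HCCMUnconditional`; programme R90-TF (brief `director/R90-BRIEF.v2.md`
1f40d54518340a35), section S5 = Ch. 13.3 (base `R90-C133`), seat R90-C133-p01 (g0), socket S5#4 ROAD α; S5 RULING OF RECORD 15:57:13Z (J2) «`(𝔨) (hlaws)` + pins are FINE as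
THEOREM hypotheses — helpers, honest, frozen», (J3) «S5 will then prove «pins hold for THE datum» + `Laws(THE datum) → (QS-R♯) ∧ …` from the ★ helpers»; JQ-S7-9 (S7 consumer
bytes: the RIGID-CORE clause wants `{πⁿ ∘ e, πˢ}` with no print-vacuous `π² ∘ e`).  Lane `--supports stmt-HodgeConjecture-24833 --as helper`; ONE theorem, no definition, no
instance, no notation, no `sorry`; Lines-free.  Sibling of ★ `rigidCoreScQsAt_of_laws_of_pins` (p861486): same datum, same pins, SHARPER conclusion (all constituents, no
supercuspidality hypothesis, no `π² ∘ e`), using in addition the socket's own transfer-existence binder `hexv` and the Haar `ν_{G,v}` for the ★ uniqueness of the signed partner.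
HONEST LABEL: HC_CM is proved only modulo the 7 printed citations (2 remaining named inputs: hLiu418 = stmt-HodgeConjecture-24832, h413 = stmt-HodgeConjecture-24833)
until rung 0 closes; this file proves NO printed global statement outright — it proves print's §13.10 ¶3 deduction «`P ∈ Π(ξ)` ⇒ `P_v ∈ {πⁿ, πˢ}(ξ_v)`» FROM `𝔨.Laws` (class P on a
posited datum — junk-satisfiable ALONE, kernel cert `CertJunkTwistedComparison` bdd77acf197a3ad2) and the pins; the content enters when `𝔨` is S10's CONCRETE datum (J3).

## Pins (as in p861486; each USED; hypotheses on ONE `𝔨`, L8-clean)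
`cls ∕ hPin_m` [§13.3 p. 201] · `ξH ∕ hPin_1dim ∕ hPin_notTheta` [§13.3 p. 202; L. 13.6.3 (c)] · `hPin_germ : MemXiFamily P … ξ → germRep cls = germI ξH` [Prop 13.2.2 (d); road γ] ·
`πsRec ∕ hPin_memA` «`cls ∈ Π(ξH)` ⇒ every `v`-constituent of `P` is `πⁿ ∘ e` or `πsRec`» [§13.3 p. 201; §13.1 p. 199 l. 6] · `hS3` «`⟨πⁿ ∘ e, some πsRec⟩` satisfies the SIGNED
[13.1.4]» [Prop 13.1.4].  THE PROOF: ★ `mem_aPacket_of_m_ne_zero_of_laws` puts `cls` in `Π(ξH)`; `hPin_memA` gives `c = πⁿ ∘ e ∨ c = πsRec`; in the second case `πsRec` and the chosen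
`((hQS ξ).1 v …).πs` are two signed partners of the same `πⁿ ∘ e`, so they are EQUAL (★ `eq_πs_of_charIdentityAtTestSigned`, `ε_v = ±1 ≠ 0`, transfer exists `hexv`).

[cite: Rogawski1990, §13.10 pp. 230–231; Thm 13.3.5 p. 202, Thm 13.3.7 p. 203; §13.3 p. 201; §13.1 p. 199, Prop. 13.1.3 (d), Prop. 13.1.4; §13.8 Prop. 13.8.1 p. 213; §4.9 Prop. 4.9.1 (a) p. 55]
[cite: LanglandsShelstad1987, §1]
-/

set_option autoImplicit false
-- the mandated namespace repeats the single-problem summit's segment (`HodgeConjecture.HodgeConjecture`)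
set_option linter.dupNamespace false

noncomputable section

open NumberField IsDedekindDomain MeasureTheory
open scoped Matrix ComplexOrder

open Literature.NumberTheory Literature.NumberTheory.Automorphic Literature.NumberTheory.Automorphic.UnitaryGroup
open Literature.NumberTheory.Automorphic.IdeleClassGroup
open Literature.NumberTheory.GaloisRepresentations
open Literature.NumberTheory.Rogawski1990
open Summit.HodgeConjecture.HodgeConjecture.Cruxes.H413

namespace Summit.HodgeConjecture.HodgeConjecture.R90.S5

set_option synthInstance.maxHeartbeats 400000 in
set_option maxHeartbeats 8000000 in
open scoped Classical in
/-- **(QS-R♯) AT ONE INSTANCE `(L, P, ξ, v)` from a lawful datum + pins**: with the (QS-U) local data at `v` (families `Δ, m_H, m_G, ν_G, ν_H`, the SIGNED Q-package `hQS`,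
transfer existence `hexv` at `v`, Haar `ν_{G,v}`), a lawful ★ twisted-comparison datum `𝔨` and the pins `cls ∕ hPin_m ∕ ξH ∕ hPin_1dim ∕ hPin_notTheta ∕ hPin_germ ∕ πsRec ∕
hPin_memA ∕ hS3` reading `(P, ξ, v)`: EVERY `v`-constituent `c` of the discrete `P` with `MemXiFamily P … ξ` is `πⁿ(ξ_v) ∘ e` OR `((hQS ξ).1 v …).πs` — «`P_v ∈ Π(ξ_v) =
{πⁿ(ξ_v), πˢ(ξ_v)}`», no `π² ∘ e`.  (★ `mem_aPacket_of_m_ne_zero_of_laws` ⇒ `cls ∈ Π(ξH)` ⇒ `hPin_memA`; ★ `eq_πs_of_charIdentityAtTestSigned` identifies `πsRec` with the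
chosen partner.) [cite: Rogawski1990, §13.10 pp. 230–231; Thm 13.3.7 p. 203; §13.3 p. 201; §13.1 Prop. 13.1.3 (d), Prop. 13.1.4 p. 199] -/
theorem xiRigiditySharpQsAt_of_laws_of_pins (L : Type) [Field L] [NumberField L] [IsCMField L]
    [∀ v : HeightOneSpectrum (𝓞 ↥(maximalRealSubfield L)), MeasurableSpace ((cmDatum L 3 (qsForm L)).Local v)]
    [∀ v : HeightOneSpectrum (𝓞 ↥(maximalRealSubfield L)),
      MeasurableSpace ((cmDatum L 2 (Matrix.of fun i j : Fin 2 => if i.val + j.val + 1 = 2 then (1 : L) else 0)).Local v ×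
        (cmDatum L 1 (Matrix.of fun i j : Fin 1 => if i.val + j.val + 1 = 1 then (1 : L) else 0)).Local v)]
    [∀ (v : HeightOneSpectrum (𝓞 ↥(maximalRealSubfield L)))
        (a : ((cmDatum L 2 (Matrix.of fun i j : Fin 2 => if i.val + j.val + 1 = 2 then (1 : L) else 0)).Local v ×
          (cmDatum L 1 (Matrix.of fun i j : Fin 1 => if i.val + j.val + 1 = 1 then (1 : L) else 0)).Local v)),
      MeasurableSpace (((cmDatum L 2 (Matrix.of fun i j : Fin 2 => if i.val + j.val + 1 = 2 then (1 : L) else 0)).Local v ×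
          (cmDatum L 1 (Matrix.of fun i j : Fin 1 => if i.val + j.val + 1 = 1 then (1 : L) else 0)).Local v) ⧸
        Subgroup.centralizer ({a} : Set ((cmDatum L 2 (Matrix.of fun i j : Fin 2 => if i.val + j.val + 1 = 2 then (1 : L) else 0)).Local v ×
          (cmDatum L 1 (Matrix.of fun i j : Fin 1 => if i.val + j.val + 1 = 1 then (1 : L) else 0)).Local v)))]
    [∀ (v : HeightOneSpectrum (𝓞 ↥(maximalRealSubfield L))) (γ : (cmDatum L 3 (qsForm L)).Local v),
      MeasurableSpace ((cmDatum L 3 (qsForm L)).Local v ⧸ Subgroup.centralizer ({γ} : Set ((cmDatum L 3 (qsForm L)).Local v)))]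
    (Δ : ∀ v : HeightOneSpectrum (𝓞 ↥(maximalRealSubfield L)), LocalTransferFactor L (qsForm L) v)
    (mH : ∀ v : HeightOneSpectrum (𝓞 ↥(maximalRealSubfield L)),
      OrbitalMeasureFamily ((cmDatum L 2 (Matrix.of fun i j : Fin 2 => if i.val + j.val + 1 = 2 then (1 : L) else 0)).Local v ×
        (cmDatum L 1 (Matrix.of fun i j : Fin 1 => if i.val + j.val + 1 = 1 then (1 : L) else 0)).Local v))
    (mG : ∀ v : HeightOneSpectrum (𝓞 ↥(maximalRealSubfield L)), OrbitalMeasureFamily ((cmDatum L 3 (qsForm L)).Local v))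
    (νG : ∀ v : HeightOneSpectrum (𝓞 ↥(maximalRealSubfield L)), Measure ((cmDatum L 3 (qsForm L)).Local v))
    (νH : ∀ v : HeightOneSpectrum (𝓞 ↥(maximalRealSubfield L)),
      Measure ((cmDatum L 2 (Matrix.of fun i j : Fin 2 => if i.val + j.val + 1 = 2 then (1 : L) else 0)).Local v ×
        (cmDatum L 1 (Matrix.of fun i j : Fin 1 => if i.val + j.val + 1 = 1 then (1 : L) else 0)).Local v))
    [∀ v : HeightOneSpectrum (𝓞 ↥(maximalRealSubfield L)), BorelSpace ((cmDatum L 3 (qsForm L)).Local v)]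
    [∀ v, (νG v).IsHaarMeasure]
    (μω : HeckeCharacter L) (hμu : μω.IsUnitary)
    (hQS : CMCharIdentityPackageTestSigned L (qsForm L) (F0P3cStCharTSCharField.qsForm_map_cmConjRingHom_transpose L) (F0P3cStCharTSShellOrbitalG.isUnit_det_qsForm L) νH νG μω hμu Δ mH mG)
    (ξ : OneDimAutRepH L)
    (μA : Measure (adelicGroupData (↥(maximalRealSubfield L)) L (IsCMField.complexConj L) 3 (qsForm L)).automorphicQuotient)
    [(adelicGroupData (↥(maximalRealSubfield L)) L (IsCMField.complexConj L) 3 (qsForm L)).IsAutomorphicMeasure μA]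
    (P : DiscreteAutomorphicRep (adelicGroupData (↥(maximalRealSubfield L)) L (IsCMField.complexConj L) 3 (qsForm L)) μA)
    (hmem : MemXiFamily P (F0P3cStCharTSCharField.qsForm_map_cmConjRingHom_transpose L) (F0P3cStCharTSShellOrbitalG.isUnit_det_qsForm L) μω hμu ξ)
    (v : HeightOneSpectrum (𝓞 ↥(maximalRealSubfield L))) (hns : ∀ w : PlacesOver L v, IsCMField.complexConj L • w.1 = w.1)
    (hexv : IsLocalDeltaTransferExists L (qsForm L) v (Δ v) (mH v) (mG v) Literature.NumberTheory.Rogawski1990.IsLocSmooth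
      Literature.NumberTheory.Rogawski1990.IsLocSmooth)
    (T : GL (Fin 3) (LocalRing L v)) (a : LocalRing L v) (ha : IsUnit a)
    (h : formCongr (conjLocal L (IsCMField.complexConj L) v) T ((qsForm L).map (algebraMap L (LocalRing L v))) =
      a • (Matrix.of fun i j : Fin 3 => if i.val + j.val + 1 = 3 then (1 : L) else 0).map (algebraMap L (LocalRing L v)))
    [MeasurableSpace (Gqs L v ⧸ Subgroup.center (Gqs L v))] [BorelSpace (Gqs L v ⧸ Subgroup.center (Gqs L v))]
    (μZ : Measure (Gqs L v ⧸ Subgroup.center (Gqs L v))) [μZ.IsHaarMeasure]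
    (π2 πn : IrrClass (Gqs L v))
    (hK : KeysCaseTwoLabels L v (μω.semilocalComponent L v) (torusLocalComponent L (IsCMField.complexConj L) v ξ.η)
      (torusLocalComponent L (IsCMField.complexConj L) v ξ.ψ) π2 πn)
    (hn : ¬ πn.IsSquareIntegrable μZ)
    -- the ★ dictionary datum and its printed relations
    {TGt TG TH : Type} (𝔨 : TwistedComparisonData TGt TG TH) (hlaws : 𝔨.Laws)
    -- PINS (dictionary → record), one named binder each
    (cls : 𝔨.𝔊.Rep) (hPin_m : 𝔨.𝔊.m cls ≠ 0)
    (ξH : 𝔨.𝔊.PacketH) (hPin_1dim : 𝔨.IsOneDimH ξH) (hPin_notTheta : ¬ 𝔨.𝔊.IsTheta ξH)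
    (hPin_germ : MemXiFamily P (F0P3cStCharTSCharField.qsForm_map_cmConjRingHom_transpose L) (F0P3cStCharTSShellOrbitalG.isUnit_det_qsForm L) μω hμu ξ →
      𝔨.germRep cls = 𝔨.germI ξH)
    (πsRec : IrrClass ((cmDatum L 3 (qsForm L)).Local v))
    (hPin_memA : ∀ Pk : 𝔨.𝔊.Packet, 𝔨.𝔊.IsAPacket Pk → 𝔨.𝔊.liftsTo ξH Pk → 𝔨.𝔊.mem cls Pk →
      ∀ c : IrrClass ((cmDatum L 3 (qsForm L)).Local v),
        (IrrClass.comap (localPiEquiv L (IsCMField.complexConj L) 3 (qsForm L) v) c).IsConstituentOf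
            (P.finRep.smoothPart.toRepresentation.comp (inclPlace (↥(maximalRealSubfield L)) L (IsCMField.complexConj L) 3 (qsForm L) v)) →
        c = IrrClass.comap (cmDatumLocalCongr L v T ha h).symm πn ∨ c = πsRec)
    (hS3 : (⟨IrrClass.comap (cmDatumLocalCongr L v T ha h).symm πn, some πsRec⟩ : CMLocalAPacket L (qsForm L) v).CharIdentityAtTest L (qsForm L) v
      (fun c' f => (if ∃ z : LocalRing L v, IsUnit z ∧ a = z * conjLocal L (IsCMField.complexConj L) v z then (1 : ℂ) else -1) *
      c'.smoothTrace (νG v) f)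
      (ξ.xiLocalChar v) (νH v) (Δ v) (mH v) (mG v)) :
    -- (QS-R♯) at this instance: every v-constituent of P is πⁿ ∘ e or THE chosen πˢ(ξ_v) of `hQS` (no π² ∘ e)
    ∀ c : IrrClass ((cmDatum L 3 (qsForm L)).Local v),
      (IrrClass.comap (localPiEquiv L (IsCMField.complexConj L) 3 (qsForm L) v) c).IsConstituentOf
          (P.finRep.smoothPart.toRepresentation.comp (inclPlace (↥(maximalRealSubfield L)) L (IsCMField.complexConj L) 3 (qsForm L) v)) →
      c = IrrClass.comap (cmDatumLocalCongr L v T ha h).symm πn ∨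
        c = ((hQS ξ).1 v hns T a ha h μZ π2 πn hK hn).πs := by
  intro c hc
  obtain ⟨Pk, hA, hL, hmemPk⟩ := mem_aPacket_of_m_ne_zero_of_laws 𝔨 hlaws ξH hPin_1dim hPin_notTheta
  rcases hPin_memA Pk hA hL (hmemPk cls (hPin_germ hmem) hPin_m) c hc with hπn | hπs
  · exact Or.inl hπn
  · refine Or.inr ?_
    rw [hπs]
    exact eq_πs_of_charIdentityAtTestSigned L (qsForm L) v (F0P3cStCharTSCharField.qsForm_map_cmConjRingHom_transpose L)
      (F0P3cStCharTSShellOrbitalG.isUnit_det_qsForm L) hexv (νG v) (by split_ifs <;> norm_num)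
      ((hQS ξ).1 v hns T a ha h μZ π2 πn hK hn) hS3

end Summit.HodgeConjecture.HodgeConjecture.R90.S5

end
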